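import Summits.AnomalousDissipation.AnomalousDissipation.Theorems.SolenoidalFractalHomogenisationLagrangianStepD1TailBoundDiag
import Summits.AnomalousDissipation.AnomalousDissipation.Theorems.SolenoidalFractalHomogenisationLagrangianStepSidebandPairIdentity
import Summits.AnomalousDissipation.AnomalousDissipation.Theorems.SolenoidalFractalHomogenisationLagrangianStepD1TailBoundFar
import Summits.AnomalousDissipation.AnomalousDissipation.Theorems.SolenoidalFractalHomogenisationLagrangianStepWEvenCertBlock
import HarnessLib

/-!
# K1L_D `stub_D1_residueTail` (registry v17, stmt-AnomalousDissipation-27980) — lane A4 `hbound`, CASE D: THE FORWARD COLINEAR PAIRS — the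
# fresh–fresh pair memory is `pairQS` exactly and the old state is one source slot older (helper; `--supports stmt-AnomalousDissipation-27980`)

Summits-side helper file of route `SolenoidalFractalHomogenisation` (prover seat `ad-sawtooth-k1loc-p1` g13, lane A owner; case D of the tail certificate
`Lines/onelevel-D1-tail-cert.md` §3, the 13 ordered pairs `(2l+1, 2l)`).  Everything proved; no definitions, no named facts, no sorry.
* `slots_pair_m`, `slots_pair_tau`, `cubature_pair_facts` — the two slots of a colinear pair share `m`, `φ = 0`, `τ`, and are consecutive;
* **`sum_sum_pairResp_projPerp`** — `pᵀ(R·P̂)q = pᵀ(P̂·R·P̂)q` for `R = pairResp ρ T B̂`, `P̂B̂ = B̂P̂` (the sandwich of `pairQ` is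
  immaterial: `D1ResidueCert.form_pairResp` + `Sideband.projPerp_commute_regBlock`);
* `freshMat_pair` — `freshMat S (2l+1) (2l) = slotCoef_{2l} • pairQ S (2l)`;
* **`tail_bound_caseD`** — `|tailKernel ν S p q (2l+1) (2l)| ≤ gTail·√PpSq·√PpSq`: `Sideband.meanFeedback_pair_apply` (the fresh–fresh part cancels `pairQS` EXACTLY)
  + the image of the state at `start_{2l}` read through the pickup bound after one full slot of contraction (`e^{−θ_{2l}} ≤ e^{−θmin}`).
NOT a proof of the registered stub, of the crux, or of anomalous dissipation; rung leaf F-D1 infrastructure.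
-/

set_option linter.dupNamespace false

noncomputable section

namespace Summit.AnomalousDissipation.AnomalousDissipation.Theorems.SolenoidalFractalHomogenisation.LagrangianStep.D1Tail

open Summit.AnomalousDissipation.AnomalousDissipation.Theorems
open Summit.AnomalousDissipation.AnomalousDissipation.Theorems.SolenoidalFractalHomogenisation.LagrangianStep
open Summit.AnomalousDissipation.AnomalousDissipation.Theorems.SolenoidalFractalHomogenisation.LagrangianStep.WCrossing
open Summit.AnomalousDissipation.AnomalousDissipation.Theorems.SolenoidalFractalHomogenisation.LagrangianStep.D1ResidueCert
open Summit.AnomalousDissipation.AnomalousDissipation.Theorems.SolenoidalFractalHomogenisation.LagrangianStep.D1TailCert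
open Summit.AnomalousDissipation.AnomalousDissipation.Theorems.SolenoidalFractalHomogenisation.LagrangianStep.Sideband
open Summit.AnomalousDissipation.AnomalousDissipation.Theorems.SolenoidalFractalHomogenisation.LagrangianStep.CellChain (start_stretch_stretch)
open Summit.AnomalousDissipation.AnomalousDissipation.Theorems.SolenoidalFractalHomogenisation.PermissibleCarrier
  (period_pos start_nonneg start_add_tau_le_period)
open Summit.AnomalousDissipation.AnomalousDissipation.Theorems.SolenoidalFractalHomogenisation.RealisedQuasiStaticCellLaw (start_add_tau_le_start)
open Literature.Analysis Literature.Analysis.FluidPDE Literature.Analysis.FunctionSpaces Literature.Analysis.FunctionSpaces.Torus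
open Literature.Analysis.FluidPDE.Torus Literature.Analysis.FluidPDE.LatticeShear
open Set Real Complex MeasureTheory intervalIntegral Matrix
open scoped InnerProductSpace

/-! ## §1 The colinear pairs of the cubature word -/

/-- The two slots of a colinear pair share the wave vector. [folklore] -/
theorem slots_pair_m (l : Fin 13) : (slots (sndSlot l)).m = (slots (fstSlot l)).m := by
  revert l; decide

/-- The two slots of a colinear pair share the duration. [folklore] -/
theorem slots_pair_tau (l : Fin 13) : (slots (sndSlot l)).τ = (slots (fstSlot l)).τ := by
  revert l; decide

/-- **The colinear pair `(2l+1, 2l)` of the cubature word**: same `m`, same `φ (= 0)`, same `τ`, consecutive. [folklore] -/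
theorem cubature_pair_facts (l : Fin 13) :
    (cubatureWord.phase (fstSlot l)).m = (cubatureWord.phase (sndSlot l)).m ∧
    (cubatureWord.phase (fstSlot l)).φ = (cubatureWord.phase (sndSlot l)).φ ∧
    (cubatureWord.phase (fstSlot l)).τ = (cubatureWord.phase (sndSlot l)).τ ∧
    cubatureWord.start (sndSlot l) = cubatureWord.start (fstSlot l) + (cubatureWord.phase (fstSlot l)).τ := by
  refine ⟨?_, rfl, ?_, ?_⟩
  · show (slots (fstSlot l)).m = (slots (sndSlot l)).m
    exact (slots_pair_m l).symm
  · show ((slots (fstSlot l)).τ : ℝ) = ((slots (sndSlot l)).τ : ℝ)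
    exact_mod_cast (slots_pair_tau l).symm
  · have h : (fstSlot l).val + 1 < 26 := by have := l.isLt; simp [fstSlot]; omega
    have e : sndSlot l = ⟨(fstSlot l).val + 1, h⟩ := Fin.ext (by simp [sndSlot, fstSlot])
    rw [e]
    exact start_succ cubatureWord (fstSlot l) h

/-- `m̂_{2l+1} = m̂_{2l}`. [folklore] -/
theorem mhat_pair (l : Fin 13) : mhat (cubatureWord.phase (sndSlot l)) = mhat (cubatureWord.phase (fstSlot l)) := by
  funext a
  unfold mhat
  rw [(cubature_pair_facts l).1]

/-- `slotCoef_{2l+1} = slotCoef_{2l}`. [folklore] -/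
theorem slotCoef_pair (l : Fin 13) : slotCoef cubatureWord (sndSlot l) = slotCoef cubatureWord (fstSlot l) := by
  unfold slotCoef
  rw [(cubature_pair_facts l).1, (cubature_pair_facts l).2.2.1]

/-! ## §2 The sandwich of `pairQ` is immaterial -/

/-- `pᵀ (A·P̂) q = pᵀ A (P̂q)`. [folklore] -/
theorem sum_sum_mul_projPerp (A : Matrix (Fin 3) (Fin 3) ℝ) (n : Fin 3 → ℝ) (p q : Fin 3 → ℝ) :
    ∑ i, ∑ l, p i * q l * (A * projPerp n) i l = ∑ i, ∑ j, p i * A i j * (projPerp n).mulVec q j := by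
  refine Finset.sum_congr rfl fun i _ => ?_
  simp only [Matrix.mul_apply, Matrix.mulVec, dotProduct, Finset.mul_sum]
  rw [Finset.sum_comm]
  exact Finset.sum_congr rfl fun j _ => Finset.sum_congr rfl fun l _ => by ring

/-- **THE SANDWICH IS IMMATERIAL**: `pᵀ (R·P̂) q = pᵀ (P̂·R·P̂) q` for `R = pairResp ρ T B̂`, `B̂ = regBlock S n`, `P̂ = projPerp n`, unit `n`.
[cite: Hale1980, Ch. III §1, Theorem 1.1] -/
theorem sum_sum_pairResp_projPerp (ρ T : ℝ) (S : T4) {n : Fin 3 → ℝ} (hn : ∑ a, n a ^ 2 = 1) (p q : Fin 3 → ℝ) :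
    ∑ i, ∑ l, p i * q l * (pairResp ρ T (regBlock S n) * projPerp n) i l =
      ∑ i, ∑ l, p i * q l * (projPerp n * pairResp ρ T (regBlock S n) * projPerp n) i l := by
  open scoped Matrix.Norms.Operator in
  set R := pairResp ρ T (regBlock S n) with hR
  set P := projPerp n with hP
  -- left: `pᵀ R (P̂q)`; right: `(P̂p)ᵀ R (P̂q)`
  have hL : ∑ i, ∑ l, p i * q l * (R * P) i l = ∑ i, ∑ j, p i * R i j * P.mulVec q j := sum_sum_mul_projPerp R n p q
  have hR' : ∑ i, ∑ l, p i * q l * (P * R * P) i l = ∑ k, ∑ j, P.mulVec p k * R k j * P.mulVec q j := by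
    rw [sum_sum_mul_projPerp (P * R) n p q, ← hP]
    have e1 : ∀ i j, p i * (P * R) i j * P.mulVec q j = ∑ k, p i * P i k * R k j * P.mulVec q j := by
      intro i j
      simp only [Matrix.mul_apply, Finset.mul_sum, Finset.sum_mul]
      exact Finset.sum_congr rfl fun k _ => by ring
    have e2 : ∀ k j, P.mulVec p k * R k j * P.mulVec q j = ∑ i, p i * P i k * R k j * P.mulVec q j := by
      intro k j
      rw [show P.mulVec p k = ∑ i, P k i * p i from rfl, Finset.sum_mul, Finset.sum_mul]
      refine Finset.sum_congr rfl fun i _ => ?_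
      rw [hP, projPerp_apply_comm n k i]
      ring
    simp only [e1, e2]
    calc ∑ i, ∑ j, ∑ k, p i * P i k * R k j * P.mulVec q j
        = ∑ i, ∑ k, ∑ j, p i * P i k * R k j * P.mulVec q j := Finset.sum_congr rfl fun i _ => Finset.sum_comm
      _ = ∑ k, ∑ i, ∑ j, p i * P i k * R k j * P.mulVec q j := Finset.sum_comm
      _ = ∑ k, ∑ j, ∑ i, p i * P i k * R k j * P.mulVec q j := Finset.sum_congr rfl fun k _ => Finset.sum_comm
  rw [hL, hR', hR, form_pairResp, form_pairResp]
  congr 1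
  refine intervalIntegral.integral_congr fun s _ => ?_
  congr 1
  refine intervalIntegral.integral_congr fun x _ => ?_
  congr 1
  -- pointwise: `(P̂p)·(E (P̂q)) = p·(E (P̂q))`
  set E := NormedSpace.exp (-((T * (1 + s - x)) • regBlock S n)) with hE
  have hcomm : P * E = E * P := by
    have h := ((projPerp_commute_regBlock S hn).smul_right (-(T * (1 + s - x)))).exp_right
    rw [neg_smul] at h
    exact h.eq
  have hPP : P * P = P := projPerp_mul_projPerp hn
  show ∑ i, p i * E.mulVec (P.mulVec q) i = ∑ i, P.mulVec p i * E.mulVec (P.mulVec q) i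
  symm
  calc ∑ i, P.mulVec p i * E.mulVec (P.mulVec q) i = dotProduct (P.mulVec p) (E.mulVec (P.mulVec q)) := rfl
    _ = dotProduct (Matrix.vecMul p P) (E.mulVec (P.mulVec q)) := by rw [← Matrix.vecMul_transpose P p, WEvenCert.projPerp_transpose]
    _ = dotProduct p (P.mulVec (E.mulVec (P.mulVec q))) := (Matrix.dotProduct_mulVec p P _).symm
    _ = dotProduct p (E.mulVec (P.mulVec q)) := by
        rw [Matrix.mulVec_mulVec (P.mulVec q) P E, hcomm, ← Matrix.mulVec_mulVec (P.mulVec q) E P, Matrix.mulVec_mulVec q P P, hPP]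
    _ = _ := rfl

/-! ## §3 Case D: the forward colinear pairs -/

/-- `freshMat S (2l+1) (2l) = slotCoef_{2l} • pairQ S (2l)`. [cite: ArmstrongVicol2025, §3] -/
theorem freshMat_pair (S : T4) (l : Fin 13) : freshMat S (sndSlot l) (fstSlot l) = slotCoef cubatureWord (fstSlot l) • pairQ S (fstSlot l) := by
  rw [freshMat_def, if_neg (sndSlot_ne_fstSlot l l), zero_add, Finset.sum_eq_single l]
  · rw [if_pos ⟨rfl, rfl⟩]
  · intro l' _ hl'
    rw [if_neg]
    rintro ⟨h1, _⟩
    exact hl' (sndSlot_injective h1).symm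
  · intro h; exact absurd (Finset.mem_univ l) h

set_option maxHeartbeats 400000 in
/-- **CASE D** (forward colinear pair `(j, j') = (2l+1, 2l)`): `|tailKernel ν S p q (2l+1) (2l)| ≤ gTail (2l+1) (2l) · (√PpSq_{2l+1}(p) · √PpSq_{2l}(q))`.
[cite: ArmstrongVicol2025, §3] [cite: MajdaKramer1999, §2.2.1.3 (55)] [cite: SandersVerhulstMurdock2007, Lemma 5.2.7] -/
theorem tail_bound_caseD {ν : ℝ} (hν : ν ∈ Ioc (0:ℝ) (1 / 40)) {S : T4} (hS : Torus.NearIso S (10 / 11) (11 / 10)) (p q : Fin 3 → ℝ)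
    (l : Fin 13) :
    |tailKernel ν S p q (sndSlot l) (fstSlot l)| ≤ gTail (sndSlot l) (fstSlot l) * (Real.sqrt (PpSq (sndSlot l) p) * Real.sqrt (PpSq (fstSlot l) q)) := by
  have hν' := hν
  obtain ⟨hν0, hν40⟩ := hν'
  have hν1 : ν ≤ 1 := by linarith
  set j := sndSlot l with hj
  set j' := fstSlot l with hj'
  obtain ⟨hmeq, hφ, hτ, hadj⟩ := cubature_pair_facts l
  rw [← hj, ← hj'] at hmeq hφ hτ hadj
  set W₁ := (cubatureWord.stretch MB MB_pos).stretch (1 / ν) (one_div_pos.mpr hν0) with hW₁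
  have h𝔸 : Torus.NearIso (ν • S) (ν * (10 / 11)) (ν * (11 / 10)) := hS.smul hν0.le
  have hlo : 0 < ν * (10 / 11) := by positivity
  set r := min (1:ℝ) (4 * π ^ 2 * (ν * (10 / 11))) with hr
  have hr0 : 0 ≤ r := le_min zero_le_one (by positivity)
  have hrmin : r = 4 * π ^ 2 * (ν * (10 / 11)) := min_one_viscRate ⟨hν0, hν40⟩
  have hNj' := isPeriodicResponse_cubature hν0 hS j'
  have hm : (cubatureWord.phase j).m ∈ box (R0 ν) := mem_box_cubature hν0 hν1 j
  have hm' : -(cubatureWord.phase j).m ∈ box (R0 ν) := neg_mem_box_cubature hν0 hν1 j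
  set N := response W₁ (ν • S) 1 (R0 ν) j' with hNdef
  set pC : EuclideanSpace ℂ (Fin 3) := WithLp.toLp 2 fun i => ((p i : ℝ) : ℂ) with hpC
  set qC : EuclideanSpace ℂ (Fin 3) := WithLp.toLp 2 fun i => ((q i : ℝ) : ℂ) with hqC
  set s := W₁.start j with hs
  set s' := W₁.start j' with hs'
  set L := (W₁.phase j).τ with hL
  set L' := (W₁.phase j').τ with hL'
  have hLpos : 0 < L := (W₁.phase j).τ_pos
  have hs'0 : 0 ≤ s' := start_nonneg W₁ j'
  have hs'P : s' + L' ≤ W₁.period := start_add_tau_le_period W₁ j'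
  have hadj₁ : s = s' + L' := start_stretch_stretch_adj cubatureWord MB_pos hν0 hadj
  set Bℝ := (blockGen (ν • S) 1 (W₁.phase j).m).restrictScalars ℝ with hB
  set xm := coordL (R0 ν) (-(W₁.phase j).m) (N s' qC) with hxm
  set xp := coordL (R0 ν) (W₁.phase j).m (N s' qC) with hxp
  have hxm_le : ‖xm‖ ≤ ‖N s' qC‖ := by rw [hxm]; exact norm_coordL_le _ _
  have hxp_le : ‖xp‖ ≤ ‖N s' qC‖ := by rw [hxp]; exact norm_coordL_le _ _
  obtain ⟨X, hX⟩ : ∃ X : ℝ → EuclideanSpace ℂ (Fin 3), X = fun t =>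
      (2 * Real.pi * Complex.I * ((slotEnvelope W₁ j t : ℝ) : ℂ)) •
        (slotAmp W₁ j • NormedSpace.exp ((t - s') • Bℝ) xm + starRingEnd ℂ (slotAmp W₁ j) • NormedSpace.exp ((t - s') • Bℝ) xp) := ⟨_, rfl⟩
  have hEc : Continuous fun u : ℝ => NormedSpace.exp (u • Bℝ) := continuous_iff_continuousAt.2 fun u => (hasDerivAt_exp_smul_const Bℝ u).continuousAt
  have hXc : Continuous X := by
    rw [hX]
    refine (continuous_const.mul (Complex.continuous_ofReal.comp (continuous_slotEnvelope W₁ j))).smul ?_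
    exact ((((hEc.comp (continuous_id.sub continuous_const)).clm_apply continuous_const).const_smul (slotAmp W₁ j)).add
      (((hEc.comp (continuous_id.sub continuous_const)).clm_apply continuous_const).const_smul (starRingEnd ℂ (slotAmp W₁ j))))
  -- the state at the start of the source slot
  set SUP : ℝ := 8 * π * ‖slotAmp W₁ j'‖ / r * ‖transversalProj (cubatureWord.phase j').m qC‖ with hSUP
  have hs'I : s' ∈ Icc 0 W₁.period := ⟨hs'0, by linarith [(W₁.phase j').τ_pos]⟩
  have hstate : ‖N s' qC‖ ≤ SUP := norm_response_apply_le W₁ h𝔸 hlo one_pos (R0 ν) j' hs'I qC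
  have hSUP0 : 0 ≤ SUP := by rw [hSUP]; positivity
  -- transversality
  have hxmt : transversalProj (W₁.phase j).m xm = xm := transversalProj_coordL_response W₁ h𝔸 hlo one_pos (R := R0 ν) j' hs'I qC _ _ (Or.inr rfl)
  have hxpt : transversalProj (W₁.phase j).m xp = xp := transversalProj_coordL_response W₁ h𝔸 hlo one_pos (R := R0 ν) j' hs'I qC _ _ (Or.inl rfl)
  have hEt : ∀ (τ : ℝ) (x : EuclideanSpace ℂ (Fin 3)), transversalProj (W₁.phase j).m x = x →
      transversalProj (W₁.phase j).m (NormedSpace.exp (τ • Bℝ) x) = NormedSpace.exp (τ • Bℝ) x := by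
    intro τ x hx
    have h : transversalProj (W₁.phase j).m (NormedSpace.exp (τ • Bℝ) (transversalProj (W₁.phase j).m x)) =
        NormedSpace.exp (τ • Bℝ) (transversalProj (W₁.phase j).m x) :=
      transversalProj_exp_blockGen_transversalProj S ν 1 (W₁.phase j) τ x
    simpa only [hx] using h
  have hmne : (W₁.phase j).m ≠ 0 := (W₁.phase j).m_ne
  -- the slot exponent
  have hθ : Real.exp (-(r * L')) ≤ Real.exp (-θmin) := by
    refine le_trans (le_of_eq ?_) (exp_neg_θs_le j')
    rw [hrmin, hL', hW₁, tau_stretch_stretch cubatureWord MB_pos hν0 j', viscRate_mul_slotLen hν0 j']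
  -- pointwise bound of the wrap pairing
  have hpt : ∀ t ∈ Set.uIoc s (s + L), ‖⟪pC, X t⟫_ℂ‖ ≤
      1 / (2 * ‖latticeVec (cubatureWord.phase j).m‖) * ‖transversalProj (cubatureWord.phase j).m pC‖ * (2 * (Real.exp (-θmin) * SUP)) := by
    intro t ht
    rw [Set.uIoc_of_le (by linarith)] at ht
    rw [hX]
    have hpick := norm_inner_pickup_le W₁ j t pC (hEt (t - s') xm hxmt) (hEt (t - s') xp hxpt)
    have hτ : 0 ≤ t - s' := by linarith [ht.1, (W₁.phase j').τ_pos]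
    have h1 : Real.exp (-(r * (t - s'))) ≤ Real.exp (-θmin) := by
      refine le_trans (Real.exp_le_exp.mpr ?_) hθ
      have h2 : L' ≤ t - s' := by linarith [ht.1]
      have h3 := mul_le_mul_of_nonneg_left h2 hr0
      linarith
    have hEm : ‖NormedSpace.exp ((t - s') • Bℝ) xm‖ ≤ Real.exp (-θmin) * SUP :=
      (norm_exp_blockGen_le h𝔸 hlo.le 1 hmne xm hτ).trans (mul_le_mul h1 (hxm_le.trans hstate) (norm_nonneg _) (Real.exp_pos _).le)
    have hEp : ‖NormedSpace.exp ((t - s') • Bℝ) xp‖ ≤ Real.exp (-θmin) * SUP :=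
      (norm_exp_blockGen_le h𝔸 hlo.le 1 hmne xp hτ).trans (mul_le_mul h1 (hxp_le.trans hstate) (norm_nonneg _) (Real.exp_pos _).le)
    have h0 : 0 ≤ 1 / (2 * ‖latticeVec (W₁.phase j).m‖) * ‖transversalProj (W₁.phase j).m pC‖ := by positivity
    calc ‖⟪pC, (2 * Real.pi * Complex.I * ((slotEnvelope W₁ j t : ℝ) : ℂ)) •
          (slotAmp W₁ j • NormedSpace.exp ((t - s') • Bℝ) xm + starRingEnd ℂ (slotAmp W₁ j) • NormedSpace.exp ((t - s') • Bℝ) xp)⟫_ℂ‖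
        ≤ 1 / (2 * ‖latticeVec (W₁.phase j).m‖) * ‖transversalProj (W₁.phase j).m pC‖ *
            (‖NormedSpace.exp ((t - s') • Bℝ) xm‖ + ‖NormedSpace.exp ((t - s') • Bℝ) xp‖) := hpick
      _ ≤ 1 / (2 * ‖latticeVec (W₁.phase j).m‖) * ‖transversalProj (W₁.phase j).m pC‖ * (2 * (Real.exp (-θmin) * SUP)) :=
          mul_le_mul_of_nonneg_left (by linarith) h0
      _ = _ := rfl
  -- the decomposition: the fresh–fresh part is `pairQS` exactly
  have hpair := meanFeedback_pair_apply cubatureWord MB_pos hν0 hS (by norm_num : (0:ℝ) < 10 / 11) hmeq hφ hτ hadj hm hm' qC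
  simp only at hpair
  rw [← hW₁] at hpair
  have hmh : mhat (cubatureWord.phase j) = mhat (cubatureWord.phase j') := mhat_pair l
  have hT : 4 * π ^ 2 * ‖latticeVec (cubatureWord.phase j).m‖ ^ 2 * MB * (cubatureWord.phase j).τ = slotT j' := by
    unfold slotT; rw [← hmeq, ← hτ]
  have hsc : slotCoef cubatureWord j = slotCoef cubatureWord j' := slotCoef_pair l
  have hfresh' : freshMat S j j' = slotCoef cubatureWord j' • pairQ S j' := freshMat_pair S l
  -- the two fresh pairings coincide
  have hformR : (⟪pC, Matrix.toEuclideanCLM (n := Fin 3) (𝕜 := ℂ)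
      ((pairResp cubatureWord.ramp (4 * π ^ 2 * ‖latticeVec (cubatureWord.phase j).m‖ ^ 2 * MB * (cubatureWord.phase j).τ)
        (regBlock S (mhat (cubatureWord.phase j))) * projPerp (mhat (cubatureWord.phase j))).map ((↑) : ℝ → ℂ)) qC⟫_ℂ).re =
      ∑ i, ∑ l', p i * q l' * pairQ S j' i l' := by
    rw [hpC, hqC, ← re_inner_cmat_realVec, hT, hmh]
    unfold pairQ
    exact sum_sum_pairResp_projPerp cubatureWord.ramp (slotT j') S (sum_mhat_sq (cubatureWord.phase j')) p q
  have hformF : (⟪pC, Matrix.toEuclideanCLM (n := Fin 3) (𝕜 := ℂ) ((freshMat S j j').map ((↑) : ℝ → ℂ)) qC⟫_ℂ).re =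
      slotCoef cubatureWord j' * ∑ i, ∑ l', p i * q l' * pairQ S j' i l' := by
    rw [hfresh', cmat_smul, _root_.smul_apply, inner_smul_right, Complex.re_ofReal_mul, hpC, hqC, ← re_inner_cmat_realVec]
  have hMre : (⟪pC, meanFeedback W₁ (ν • S) 1 (R0 ν) j j' qC⟫_ℂ).re =
      4 * π ^ 2 / ν * slotCoef cubatureWord j * ∑ i, ∑ l', p i * q l' * pairQ S j' i l' + (⟪pC, (1 / W₁.period) • ∫ t in s..s + L, X t⟫_ℂ).re := by
    rw [hpair, inner_add_right, Complex.add_re, inner_smul_right, Complex.re_ofReal_mul, hformR, hX]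
  have hM : ν / (4 * π ^ 2) * (⟪pC, meanFeedback W₁ (ν • S) 1 (R0 ν) j j' qC⟫_ℂ).re -
      (⟪pC, Matrix.toEuclideanCLM (n := Fin 3) (𝕜 := ℂ) ((freshMat S j j').map ((↑) : ℝ → ℂ)) qC⟫_ℂ).re =
      ν / (4 * π ^ 2) * (⟪pC, (1 / W₁.period) • ∫ t in s..s + L, X t⟫_ℂ).re := by
    rw [hMre, hformF, hsc]
    have hπ : π ≠ 0 := Real.pi_pos.ne'
    have hν0' : ν ≠ 0 := hν0.ne'
    field_simp
    ring
  exact tail_bound_of_decomp hν S p q j j' X (hXc.intervalIntegrable _ _) hM hpt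

end Summit.AnomalousDissipation.AnomalousDissipation.Theorems.SolenoidalFractalHomogenisation.LagrangianStep.D1Tail

end
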